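import Summits.QuantumFields.BalabanUV.Beta.GAN24.ContactOneGaugeCellAlgebra
import Summits.QuantumFields.BalabanUV.Beta.GAN24.ContactOneGaugeCellMaxwell
import Summits.QuantumFields.BalabanUV.Beta.GAN24.ContactOneGaugeCellBound

/-!
# `GAN24.ContactOneGaugeCell` — CT-ROUTE step CT-3a, part 2b: THE ONE-GAUGE CONTACT CELL IS `½⟨ψ_tip·T₁, d*dT₃⟩ − ½⟨ψ_mid·T₃, d*dT₁⟩` AND IS
# BOUNDED BY «ENVELOPES IN, `L^{d+1}·e^{−κ′·spread}` OUT» (the row owner's `CT3-MECHANISM.md` v1 §1(c) ∕ §3 CT-3a, offered to this seat)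

HONEST FRAMING (cell charter, verbatim): «discharging `BetaPertH` makes Bałaban's UV stability UNCONDITIONAL — a real constructive-QFT result;
it is NOT the continuum limit and NOT the Clay problem.»  DERIVED cell leaf (pub-balaban, G-an2-4 formalisation swarm → CRUX TEAM (2), seat
`b2b-balaban-gan24-formalise-leaf-02`, gen 46): [folklore] bookkeeping (finite windows, one lattice shift, the triangle inequality) over parts 1, 1b, 2a
(`ContactOneGaugeCellAlgebra`: the gauge-site laws; `ContactOneGaugeCellMaxwell`: the Maxwell contraction; `ContactOneGaugeCellBound`: the three-envelope
block sum and the generic weighted cell bound) BY NAME;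
NO cited fact, NO `def`, NO `def … : Prop`, NO wall binder; the constants are symbolic inputs (no power of the blocking hard-wired).  It discharges NO
letter of (CONV-C): the cell bound is ONE input of the owner's CT-3c assembly; NEVER «G-an2-4 closed»; NOT hS0, NOT D1, NOT `BetaPertH`, NOT continuum,
NOT Clay.  «not in print; our bookkeeping».
HONEST DEPENDENCY (cell records, verbatim): «continuum YM on T⁴ ⇐ BetaPertH ∧ nine spine estimates (0/9 proved); BetaPertH ⇐ (D1) ∧ (D4) ∧ CAP+tail;
G-an2-4 gates asym, D1 and NE2/3/4.»
ABSOLUTE RULE (cell charter, verbatim): «No internally-minted statement may enter as a cited fact. Every hypothesis is either kernel-proved in this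
package or a verbatim quotation of a PUBLISHED theorem with page reference. The manuscript(s) under audit are NOT citable for their own disputed steps —
they are the thing under adjudication; programme-internal (2001/route/tribunal) claims are never citable.»

THE OBJECTS (generic `d`, `D = d+1`, lattice `ℤ^D`; blocking `L ≥ 1`; envelope `E_z(u) := e^{−κ₀‖quo L u − z‖∞}` of `RespStepDecay`∕`EnvelopeBlockSum`;
`e_κ := B6BondElimination.unitVec κ`; `d*d := curvAdj ∘ curv`).  A gauge function `ψ : ℤ^D → ℝ` (the consumer's: leaf-01's `Ψ`-kernel `Psi_delta1_envelope`), an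
INDEX leg `T₁` and a TABLE leg `T₃` (`Form1`; the consumer's: the undressed one-shot minimiser columns `wH`, (N1) = `FineReadoutDecay.exists_wH_decay`, their
Maxwell envelopes (N1-EL) = `RemainderExplicitLaplacian.exists_curvAdj_curv_wH_decay`).  After part 1's gauge-site law the one-gauge contact summand at index
bond `(κ′,u)` and table leg `(β,z)` is `T₃ β z·(½(ψ(u+e_{κ′}) − ½(ψ z + ψ(z+e_β)))·(d*d δ_{(κ′,u)})_β z)`.
## What is proved
* (part 2a `ContactOneGaugeCellBound`: `tsum_env3_le`, `abs_tsum_weight_mul_mul_le`, the tip ∕ midpoint ∕ site weights.)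
* §1 `sum_mul_window_eq`, `sum_mul_curvAdj_curv_eq_window` (finite rearrangements) and THE SWAP `tsum_mul_window_eq_tsum_mul_curvAdj_curv` (index-leg sum ↔ table-leg sum through the `cube 2` window of the `d*d` matrix, one lattice shift, for a
  summable index leg and ANY bounded weight-leg `m`): `Σ'_u Σ_{κ′} T₁ κ′ u·(Σ_{v∈cube 2} Σ_β (d*dδ_{(κ′,0)})_β v·m β (u+v)) = Σ'_z Σ_β m β z·(d*d T₁)_β z`.
* §2 THE CELL IDENTITY **`cell_eq`** (sup hypotheses only): `Σ'_u Σ_{κ′} T₁ κ′ u·Σ'_z Σ_β T₃ β z·(½(ψ(u+e_{κ′}) − ½(ψ z + ψ(z+e_β)))·(d*dδ_{(κ′,u)})_β z)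
  = ½·Σ'_u Σ_{κ′} ψ(u+e_{κ′})·T₁ κ′ u·(d*dT₃)_{κ′} u − ½·Σ'_z Σ_β ½(ψ z + ψ(z+e_β))·T₃ β z·(d*dT₁)_β z` (= the owner's `½⟨ψ_tip·T₁, d*dT₃⟩ − ½⟨ψ_mid·T₃, d*dT₁⟩`),
  and THE CELL BOUND **`abs_cell_le`** (envelope hypotheses): `|cell| ≤ ½(d+1)·E_ψ e^{κ₀}·(E₁M₃ + E₃M₁)·L^{d+1}·Zl(κ₀/(4(d+1)))·e^{−(κ₀/12)(‖z₁−z₀‖∞+‖z₃−z₀‖∞)}`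
  — with the consumer's letters `E_ψ = O(N^{−D})`, `E₁, E₃ = O(N^{−(D+1)})`, `M₁, M₃ = O(N^{−(D+3)})`, `L = N`: the MAIN ORDER `N^{−2D−4}`, no power of `N` lost,
  NO second-difference letter, NO cancellation (the summation by parts is the KKT system's own, `d*d wH = 𝒬ᵀwΦ`).  `cell_right_eq` (second table slot, sign `−`)
  and **`cellIdx_eq`** ∕ **`abs_cellIdx_le`** (the INDEX slot, SITE weights: `½·Σ' ψ_site·T_R·d*dT_L − ½·Σ' ψ_site·T_L·d*dT_R`).
Provenance: seat b2b-balaban-gan24-formalise-leaf-02 gen 46 (prover-…-leaf-02-g46-0), 2026-08-21; over the files named above BY NAME.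
-/

namespace Summit.QuantumFields.BalabanUV.Beta.GAN24.ContactOneGaugeCell

open Finset
open scoped BigOperators
open Literature.MathematicalPhysics.QuantumFieldTheory.LatticeForm (quo)
open Literature.MathematicalPhysics.QuantumFieldTheory.Balaban1983to89
open Literature.MathematicalPhysics.QuantumFieldTheory.Balaban1983to89.Beta
open B12Sec2to5 (l1 l1_nonneg)
open B4ContourShift (supNorm supNorm_nonneg)
open ExpKernelCalculus (Zl Zl_nonneg Zl_pos)
open StepJetData (l1_unitVec)
open AffineAveraging (Form1 curv curvAdj)
open B6BondElimination (unitVec unitVec_apply)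
open KKTFluctuationKernel (delta1 delta1_apply)
open Summit.QuantumFields.BalabanUV.Beta.AxialDressingRooted (cube mem_cube)
open Summit.QuantumFields.BalabanUV.Beta.BorderedHessian (curvAdj_curv_delta1_symm)
open Summit.QuantumFields.BalabanUV.Beta.GAN24.ContactOneGaugeCellBound (abs_tsum_weight_mul_mul_le abs_tip_weight_le abs_mid_weight_le
  abs_site_weight_le abs_le_of_env summable_of_env)
open Summit.QuantumFields.BalabanUV.Beta.GAN24.ContactOneGaugeCellMaxwell (tsum_mul_curvAdj_curv_delta1 tsum_mul_curvAdj_curv_delta1_eq_window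
  sum_window_curvAdj_curv_delta1_mul_sub)

noncomputable section

variable {d : ℕ}

/-! ## §1 The swap: index-leg sum ↔ table-leg sum through the `cube 2` window -/

section Swap

/-- [folklore] A summable index leg against a bounded window expression is summable. -/
theorem summable_mul_window {T₁ m : Form1 (d + 1) ℝ} (hT₁ : ∀ κ, Summable (T₁ κ)) {Bm : ℝ} (hm : ∀ β z, |m β z| ≤ Bm)
    (v : Fin (d + 1) → ℤ) :
    Summable fun u => ∑ κ', ∑ β, T₁ κ' u * (curvAdj (curv (delta1 κ' 0)) β v * m β (u + v)) := by
  refine summable_sum fun κ' _ => summable_sum fun β _ => ?_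
  refine Summable.of_norm_bounded (((hT₁ κ').abs).mul_right (|curvAdj (curv (delta1 κ' 0)) β v| * Bm)) (fun u => ?_)
  rw [Real.norm_eq_abs, abs_mul, abs_mul]
  have h0 : 0 ≤ |T₁ κ' u| * |curvAdj (curv (delta1 κ' 0)) β v| := by positivity
  calc |T₁ κ' u| * (|curvAdj (curv (delta1 κ' 0)) β v| * |m β (u + v)|)
      = |T₁ κ' u| * |curvAdj (curv (delta1 κ' 0)) β v| * |m β (u + v)| := by ring
    _ ≤ |T₁ κ' u| * |curvAdj (curv (delta1 κ' 0)) β v| * Bm := mul_le_mul_of_nonneg_left (hm β _) h0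
    _ = |T₁ κ' u| * (|curvAdj (curv (delta1 κ' 0)) β v| * Bm) := by ring

/-- [folklore] Distributing the index leg into the window: `Σ_{κ′} T₁ κ′ u·(Σ_v Σ_β c·m) = Σ_v Σ_{κ′} Σ_β T₁ κ′ u·(c·m)` (finite sums). -/
theorem sum_mul_window_eq (T₁ m : Form1 (d + 1) ℝ) (u : Fin (d + 1) → ℤ) :
    (∑ κ', T₁ κ' u * (∑ v ∈ cube (d + 1) 2, ∑ β, curvAdj (curv (delta1 κ' 0)) β v * m β (u + v))) =
      ∑ v ∈ cube (d + 1) 2, ∑ κ', ∑ β, T₁ κ' u * (curvAdj (curv (delta1 κ' 0)) β v * m β (u + v)) := by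
  simp only [Finset.mul_sum]
  exact Finset.sum_comm

/-- [folklore] Distributing the weighted table leg into the dual window, read at the shifted index site:
`Σ_β m β z·(d*dT₁)_β z = Σ_v Σ_{κ′} Σ_β T₁ κ′ (z − v)·((d*dδ_{(κ′,0)})_β v·m β (z − v + v))`. -/
theorem sum_mul_curvAdj_curv_eq_window (T₁ m : Form1 (d + 1) ℝ) (z : Fin (d + 1) → ℤ) :
    (∑ β, m β z * curvAdj (curv T₁) β z) =
      ∑ v ∈ cube (d + 1) 2, ∑ κ', ∑ β, T₁ κ' (z - v) * (curvAdj (curv (delta1 κ' 0)) β v * m β (z - v + v)) := by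
  have e : ∀ β, m β z * curvAdj (curv T₁) β z =
      ∑ v ∈ cube (d + 1) 2, ∑ κ', T₁ κ' (z - v) * (curvAdj (curv (delta1 κ' 0)) β v * m β (z - v + v)) := by
    intro β
    rw [← sum_window_curvAdj_curv_delta1_mul_sub T₁ β z, Finset.mul_sum]
    refine Finset.sum_congr rfl fun v _ => ?_
    rw [Finset.mul_sum]
    refine Finset.sum_congr rfl fun κ' _ => ?_
    rw [sub_add_cancel]
    ring
  rw [Finset.sum_congr rfl fun β _ => e β, Finset.sum_comm]
  refine Finset.sum_congr rfl fun v _ => ?_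
  exact Finset.sum_comm

/-- [folklore] **THE SWAP** — for a summable index leg `T₁` and ANY bounded 1-form `m` (the weighted table leg):
`Σ'_u Σ_{κ′} T₁ κ′ u·(Σ_{v ∈ cube 2} Σ_β (d*d δ_{(κ′,0)})_β v·m β (u+v)) = Σ'_z Σ_β m β z·(d*d T₁)_β z` — the table-leg sum is finite for each index bond
(part 1b's window form), the index-leg sum is absolutely convergent, and the one lattice shift `u = z − v` per window offset exchanges them. -/
theorem tsum_mul_window_eq_tsum_mul_curvAdj_curv {T₁ m : Form1 (d + 1) ℝ} (hT₁ : ∀ κ, Summable (T₁ κ)) {Bm : ℝ} (hm : ∀ β z, |m β z| ≤ Bm) :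
    ∑' u, ∑ κ', T₁ κ' u * (∑ v ∈ cube (d + 1) 2, ∑ β, curvAdj (curv (delta1 κ' 0)) β v * m β (u + v)) =
      ∑' z, ∑ β, m β z * curvAdj (curv T₁) β z := by
  have hfs : ∀ v, Summable fun u => ∑ κ', ∑ β, T₁ κ' u * (curvAdj (curv (delta1 κ' 0)) β v * m β (u + v)) :=
    fun v => summable_mul_window hT₁ hm v
  have hfs' : ∀ v, Summable fun z => ∑ κ', ∑ β, T₁ κ' (z - v) * (curvAdj (curv (delta1 κ' 0)) β v * m β (z - v + v)) := by
    intro v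
    refine ((Equiv.subRight v).summable_iff.2 (hfs v)).congr fun z => ?_
    simp only [Function.comp_apply, Equiv.subRight_apply]
  have hshift : ∀ v, ∑' u, ∑ κ', ∑ β, T₁ κ' u * (curvAdj (curv (delta1 κ' 0)) β v * m β (u + v)) =
      ∑' z, ∑ κ', ∑ β, T₁ κ' (z - v) * (curvAdj (curv (delta1 κ' 0)) β v * m β (z - v + v)) := by
    intro v
    rw [← (Equiv.subRight v).tsum_eq (fun u => ∑ κ', ∑ β, T₁ κ' u * (curvAdj (curv (delta1 κ' 0)) β v * m β (u + v)))]
    simp only [Equiv.subRight_apply]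
  calc ∑' u, ∑ κ', T₁ κ' u * (∑ v ∈ cube (d + 1) 2, ∑ β, curvAdj (curv (delta1 κ' 0)) β v * m β (u + v))
      = ∑' u, ∑ v ∈ cube (d + 1) 2, ∑ κ', ∑ β, T₁ κ' u * (curvAdj (curv (delta1 κ' 0)) β v * m β (u + v)) :=
        tsum_congr fun u => sum_mul_window_eq T₁ m u
    _ = ∑ v ∈ cube (d + 1) 2, ∑' u, ∑ κ', ∑ β, T₁ κ' u * (curvAdj (curv (delta1 κ' 0)) β v * m β (u + v)) :=
        Summable.tsum_finsetSum fun v _ => hfs v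
    _ = ∑ v ∈ cube (d + 1) 2, ∑' z, ∑ κ', ∑ β, T₁ κ' (z - v) * (curvAdj (curv (delta1 κ' 0)) β v * m β (z - v + v)) :=
        Finset.sum_congr rfl fun v _ => hshift v
    _ = ∑' z, ∑ v ∈ cube (d + 1) 2, ∑ κ', ∑ β, T₁ κ' (z - v) * (curvAdj (curv (delta1 κ' 0)) β v * m β (z - v + v)) :=
        (Summable.tsum_finsetSum fun v _ => hfs' v).symm
    _ = ∑' z, ∑ β, m β z * curvAdj (curv T₁) β z := tsum_congr fun z => (sum_mul_curvAdj_curv_eq_window T₁ m z).symm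

end Swap

/-! ## §2 The cell identity and the cell bound (first table slot; second slot; index slot) -/

section Cell

variable {ψ : (Fin (d + 1) → ℤ) → ℝ} {T₁ T₃ : Form1 (d + 1) ℝ}

/-- [folklore] **THE INNER (TABLE-LEG) SUM OF THE CELL IS FINITE AND SPLITS** into the tip part (the Maxwell operator moved onto `T₃`) and the windowed
midpoint part: `Σ'_z Σ_β T₃ β z·(½(ψ(u+e_{κ′}) − ½(ψ z + ψ(z+e_β)))·(d*dδ_{(κ′,u)})_β z)
  = ½ψ(u+e_{κ′})·(d*dT₃)_{κ′} u − ½·Σ_{v∈cube 2} Σ_β (d*dδ_{(κ′,0)})_β v·(½(ψ(u+v) + ψ(u+v+e_β))·T₃ β (u+v))` — no hypothesis (part 1b's window form). -/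
theorem inner_eq (ψ : (Fin (d + 1) → ℤ) → ℝ) (T₃ : Form1 (d + 1) ℝ) (κ' : Fin (d + 1)) (u : Fin (d + 1) → ℤ) :
    ∑' z, ∑ β, T₃ β z * ((1 / 2 : ℝ) * (ψ (u + unitVec κ') - (ψ z + ψ (z + unitVec β)) / 2) * curvAdj (curv (delta1 κ' u)) β z) =
      (1 / 2 : ℝ) * ψ (u + unitVec κ') * curvAdj (curv T₃) κ' u -
        (1 / 2 : ℝ) * ∑ v ∈ cube (d + 1) 2, ∑ β, curvAdj (curv (delta1 κ' 0)) β v *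
          ((ψ (u + v) + ψ (u + v + unitVec β)) / 2 * T₃ β (u + v)) := by
  have hsplit : ∀ z, (∑ β, T₃ β z * ((1 / 2 : ℝ) * (ψ (u + unitVec κ') - (ψ z + ψ (z + unitVec β)) / 2) * curvAdj (curv (delta1 κ' u)) β z)) =
      (1 / 2 : ℝ) * ψ (u + unitVec κ') * (∑ β, T₃ β z * curvAdj (curv (delta1 κ' u)) β z) -
        (1 / 2 : ℝ) * (∑ β, (ψ z + ψ (z + unitVec β)) / 2 * T₃ β z * curvAdj (curv (delta1 κ' u)) β z) := by
    intro z
    rw [Finset.mul_sum, Finset.mul_sum, ← Finset.sum_sub_distrib]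
    refine Finset.sum_congr rfl fun β _ => ?_
    ring
  have hs1 : Summable fun z => ∑ β, T₃ β z * curvAdj (curv (delta1 κ' u)) β z :=
    ContactOneGaugeCellMaxwell.summable_mul_curvAdj_curv_delta1 T₃ κ' u
  have hs2 : Summable fun z => ∑ β, (ψ z + ψ (z + unitVec β)) / 2 * T₃ β z * curvAdj (curv (delta1 κ' u)) β z :=
    ContactOneGaugeCellMaxwell.summable_mul_curvAdj_curv_delta1 (fun β z => (ψ z + ψ (z + unitVec β)) / 2 * T₃ β z) κ' u
  rw [tsum_congr hsplit, (hs1.mul_left _).tsum_sub (hs2.mul_left _), tsum_mul_left, tsum_mul_left,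
    tsum_mul_curvAdj_curv_delta1_eq_window (fun β z => (ψ z + ψ (z + unitVec β)) / 2 * T₃ β z) κ' u, tsum_mul_curvAdj_curv_delta1 T₃ κ' u]

/-- [folklore] **THE CELL IDENTITY** (sup hypotheses only: `T₁` summable, `ψ`, `T₃`, `d*dT₃` bounded):
`Σ'_u Σ_{κ′} T₁ κ′ u·Σ'_z Σ_β T₃ β z·(½(ψ(u+e_{κ′}) − ½(ψ z + ψ(z+e_β)))·(d*dδ_{(κ′,u)})_β z)
   = ½·Σ'_u Σ_{κ′} ψ(u+e_{κ′})·T₁ κ′ u·(d*dT₃)_{κ′} u − ½·Σ'_z Σ_β ½(ψ z + ψ(z+e_β))·T₃ β z·(d*dT₁)_β z`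
— the owner's `C₁(ψ; T₁, T₃) = ⟨ψ_tip·T₁, d*dT₃⟩ − ⟨ψ_mid·T₃, d*dT₁⟩` (up to the overall `½` of the table law), the gauge function UNDIFFERENTIATED against the Maxwell
operator of the other two legs. -/
theorem cell_eq (hT₁ : ∀ κ, Summable (T₁ κ)) {Bψ B₃ BM : ℝ} (hψ : ∀ x, |ψ x| ≤ Bψ) (hT₃ : ∀ β z, |T₃ β z| ≤ B₃)
    (hM₃ : ∀ κ u, |curvAdj (curv T₃) κ u| ≤ BM) :
    ∑' u, ∑ κ', T₁ κ' u *
        ∑' z, ∑ β, T₃ β z * ((1 / 2 : ℝ) * (ψ (u + unitVec κ') - (ψ z + ψ (z + unitVec β)) / 2) * curvAdj (curv (delta1 κ' u)) β z) =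
      (1 / 2 : ℝ) * ∑' u, ∑ κ', ψ (u + unitVec κ') * T₁ κ' u * curvAdj (curv T₃) κ' u -
        (1 / 2 : ℝ) * ∑' z, ∑ β, (ψ z + ψ (z + unitVec β)) / 2 * T₃ β z * curvAdj (curv T₁) β z := by
  have hBψ : 0 ≤ Bψ := (abs_nonneg _).trans (hψ 0)
  -- the bounded weighted table leg
  set m : Form1 (d + 1) ℝ := fun β z => (ψ z + ψ (z + unitVec β)) / 2 * T₃ β z with hm
  have hmB : ∀ β z, |m β z| ≤ Bψ * B₃ := by
    intro β z
    rw [hm]; dsimp only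
    rw [abs_mul, abs_div, abs_two]
    have h1 := hψ z; have h2 := hψ (z + unitVec β); have h3 := hT₃ β z
    have h4 := abs_add_le (ψ z) (ψ (z + unitVec β))
    have h5 : |ψ z + ψ (z + unitVec β)| / 2 ≤ Bψ := by linarith
    exact mul_le_mul h5 h3 (abs_nonneg _) hBψ
  -- summand-wise split of the outer sum
  have houter : ∀ u, (∑ κ', T₁ κ' u *
      ∑' z, ∑ β, T₃ β z * ((1 / 2 : ℝ) * (ψ (u + unitVec κ') - (ψ z + ψ (z + unitVec β)) / 2) * curvAdj (curv (delta1 κ' u)) β z)) =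
      (1 / 2 : ℝ) * (∑ κ', ψ (u + unitVec κ') * T₁ κ' u * curvAdj (curv T₃) κ' u) -
        (1 / 2 : ℝ) * (∑ κ', T₁ κ' u * (∑ v ∈ cube (d + 1) 2, ∑ β, curvAdj (curv (delta1 κ' 0)) β v * m β (u + v))) := by
    intro u
    rw [Finset.mul_sum, Finset.mul_sum, ← Finset.sum_sub_distrib]
    refine Finset.sum_congr rfl fun κ' _ => ?_
    rw [inner_eq ψ T₃ κ' u]
    ring
  -- summability of the two outer parts
  have hsA : Summable fun u => ∑ κ', ψ (u + unitVec κ') * T₁ κ' u * curvAdj (curv T₃) κ' u := by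
    refine summable_sum fun κ' _ => Summable.of_norm_bounded ((((hT₁ κ').abs).mul_left Bψ).mul_right BM) (fun u => ?_)
    rw [Real.norm_eq_abs, abs_mul, abs_mul]
    have h1 := hψ (u + unitVec κ'); have h3 := hM₃ κ' u
    have h0 : 0 ≤ |T₁ κ' u| := abs_nonneg _
    calc |ψ (u + unitVec κ')| * |T₁ κ' u| * |curvAdj (curv T₃) κ' u| ≤ Bψ * |T₁ κ' u| * BM := by gcongr
      _ = _ := by ring
  have hsB : Summable fun u => ∑ κ', T₁ κ' u * (∑ v ∈ cube (d + 1) 2, ∑ β, curvAdj (curv (delta1 κ' 0)) β v * m β (u + v)) :=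
    (summable_sum (s := cube (d + 1) 2) fun v (_ : v ∈ cube (d + 1) 2) => summable_mul_window hT₁ hmB v).congr
      fun u => (sum_mul_window_eq T₁ m u).symm
  rw [tsum_congr houter, (hsA.mul_left _).tsum_sub (hsB.mul_left _), tsum_mul_left, tsum_mul_left,
    tsum_mul_window_eq_tsum_mul_curvAdj_curv hT₁ hmB]

/-- [folklore] **THE ONE-GAUGE CELL BOUND (first table slot)** — «ENVELOPES IN, `L^{d+1}·e^{−κ′·spread}` OUT»: block envelopes for the gauge function
(`E_ψ`, centre `z₀`), the two legs (`E₁, E₃`, centres `z₁, z₃`) and their Maxwell images (`M₁, M₃`) give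
`|cell| ≤ ½(d+1)·E_ψ·e^{κ₀}·(E₁·M₃ + E₃·M₁)·L^{d+1}·Zl(κ₀/(4(d+1)))·e^{−(κ₀/12)(‖z₁−z₀‖∞ + ‖z₃−z₀‖∞)}` — with the consumer's letters
(`E_ψ ∝ N^{−D}`, `E ∝ N^{−(D+1)}`, `M ∝ N^{−(D+3)}`, `L = N`) the main order `N^{−2D−4}`: no power lost, no second-difference letter, no cancellation. -/
theorem abs_cell_le {L : ℕ} (hL : 1 ≤ L) {κ₀ : ℝ} (hκ : 0 < κ₀) {z₀ z₁ z₃ : Fin (d + 1) → ℤ} {Eψ E₁ E₃ M₁ M₃ : ℝ}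
    (hEψ : 0 ≤ Eψ) (hE₁ : 0 ≤ E₁) (hE₃ : 0 ≤ E₃) (hM₁0 : 0 ≤ M₁) (hM₃0 : 0 ≤ M₃)
    (hψ : ∀ x, |ψ x| ≤ Eψ * Real.exp (-(κ₀ * supNorm (quo L x - z₀))))
    (hT₁ : ∀ κ u, |T₁ κ u| ≤ E₁ * Real.exp (-(κ₀ * supNorm (quo L u - z₁))))
    (hM₁ : ∀ κ u, |curvAdj (curv T₁) κ u| ≤ M₁ * Real.exp (-(κ₀ * supNorm (quo L u - z₁))))
    (hT₃ : ∀ κ u, |T₃ κ u| ≤ E₃ * Real.exp (-(κ₀ * supNorm (quo L u - z₃))))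
    (hM₃ : ∀ κ u, |curvAdj (curv T₃) κ u| ≤ M₃ * Real.exp (-(κ₀ * supNorm (quo L u - z₃)))) :
    |∑' u, ∑ κ', T₁ κ' u *
        ∑' z, ∑ β, T₃ β z * ((1 / 2 : ℝ) * (ψ (u + unitVec κ') - (ψ z + ψ (z + unitVec β)) / 2) * curvAdj (curv (delta1 κ' u)) β z)| ≤
      (1 / 2 : ℝ) * (((d : ℝ) + 1) * (Eψ * Real.exp κ₀) * (E₁ * M₃ + E₃ * M₁)) *
        ((L : ℝ) ^ (d + 1) * Zl (d + 1) (κ₀ / (4 * ((d : ℝ) + 1))) * Real.exp (-(κ₀ / 12) * (supNorm (z₁ - z₀) + supNorm (z₃ - z₀)))) := by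
  have hId := cell_eq (ψ := ψ) (T₁ := T₁) (T₃ := T₃) (fun κ => summable_of_env hL hκ (hT₁ κ)) (abs_le_of_env hκ.le hEψ hψ)
    (fun β z => abs_le_of_env hκ.le hE₃ (hT₃ β) z) (fun κ u => abs_le_of_env hκ.le hM₃0 (hM₃ κ) u)
  rw [hId]
  -- the two Maxwell pairings
  obtain ⟨_, hA⟩ := abs_tsum_weight_mul_mul_le (d := d) hL hκ (w := fun κ u => ψ (u + unitVec κ)) (T := T₁) (M := curvAdj (curv T₃))
    (by positivity) hE₁ hM₃0 (fun κ u => abs_tip_weight_le hL hκ.le hEψ hψ κ u) hT₁ hM₃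
  obtain ⟨_, hB⟩ := abs_tsum_weight_mul_mul_le (d := d) hL hκ (w := fun β z => (ψ z + ψ (z + unitVec β)) / 2) (T := T₃) (M := curvAdj (curv T₁))
    (by positivity) hE₃ hM₁0 (fun β z => abs_mid_weight_le hL hκ.le hEψ hψ β z) hT₃ hM₁
  rw [add_comm (supNorm (z₃ - z₀)) (supNorm (z₁ - z₀))] at hB
  set Bk : ℝ := (L : ℝ) ^ (d + 1) * Zl (d + 1) (κ₀ / (4 * ((d : ℝ) + 1))) * Real.exp (-(κ₀ / 12) * (supNorm (z₁ - z₀) + supNorm (z₃ - z₀))) with hBk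
  have htri := abs_sub (((1 / 2 : ℝ)) * ∑' u, ∑ κ', ψ (u + unitVec κ') * T₁ κ' u * curvAdj (curv T₃) κ' u)
    ((1 / 2 : ℝ) * ∑' z, ∑ β, (ψ z + ψ (z + unitVec β)) / 2 * T₃ β z * curvAdj (curv T₁) β z)
  rw [abs_mul, abs_mul, abs_of_pos (by norm_num : (0 : ℝ) < 1 / 2)] at htri
  have hsum : (1 / 2 : ℝ) * (((d : ℝ) + 1) * (Eψ * Real.exp κ₀) * E₁ * M₃ * Bk) + (1 / 2 : ℝ) * (((d : ℝ) + 1) * (Eψ * Real.exp κ₀) * E₃ * M₁ * Bk) =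
      (1 / 2 : ℝ) * (((d : ℝ) + 1) * (Eψ * Real.exp κ₀) * (E₁ * M₃ + E₃ * M₁)) * Bk := by ring
  rw [← hsum]
  linarith

/-- [folklore] **SECOND TABLE SLOT** — the same cell with the law's sign (`gaugeLeg_wilsonA_tsum_right`): its bracket is the NEGATIVE of the first slot's. -/
theorem cell_right_eq (ψ : (Fin (d + 1) → ℤ) → ℝ) (T₁ T₂ : Form1 (d + 1) ℝ) :
    ∑' u, ∑ κ', T₁ κ' u *
        ∑' x, ∑ α, T₂ α x * -((1 / 2 : ℝ) * (ψ (u + unitVec κ') - (ψ x + ψ (x + unitVec α)) / 2) * curvAdj (curv (delta1 κ' u)) α x) =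
      -∑' u, ∑ κ', T₁ κ' u *
        ∑' x, ∑ α, T₂ α x * ((1 / 2 : ℝ) * (ψ (u + unitVec κ') - (ψ x + ψ (x + unitVec α)) / 2) * curvAdj (curv (delta1 κ' u)) α x) := by
  rw [← tsum_neg]
  refine tsum_congr fun u => ?_
  rw [← Finset.sum_neg_distrib]
  refine Finset.sum_congr rfl fun κ' _ => ?_
  rw [← mul_neg, ← tsum_neg]
  congr 1
  refine tsum_congr fun x => ?_
  rw [← Finset.sum_neg_distrib]
  refine Finset.sum_congr rfl fun α _ => ?_
  ring

/-- [folklore] **THE INDEX-SLOT CELL IDENTITY** (SITE weights; sup hypotheses): with the two table legs `T_L` (summable) and `T_R`,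
`Σ'_x Σ_a T_L a x·Σ'_z Σ_b T_R b z·(½(ψ z − ψ x)·(d*dδ_{(b,z)})_a x) = ½·Σ'_z Σ_b ψ z·T_R b z·(d*dT_L)_b z − ½·Σ'_x Σ_a ψ x·T_L a x·(d*dT_R)_a x`. -/
theorem cellIdx_eq {TL TR : Form1 (d + 1) ℝ} (hTL : ∀ a, Summable (TL a)) {Bψ BR BM : ℝ} (hψ : ∀ x, |ψ x| ≤ Bψ)
    (hTR : ∀ b z, |TR b z| ≤ BR) (hMR : ∀ a x, |curvAdj (curv TR) a x| ≤ BM) :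
    ∑' x, ∑ a, TL a x * ∑' z, ∑ b, TR b z * ((1 / 2 : ℝ) * (ψ z - ψ x) * curvAdj (curv (delta1 b z)) a x) =
      (1 / 2 : ℝ) * ∑' z, ∑ b, ψ z * TR b z * curvAdj (curv TL) b z -
        (1 / 2 : ℝ) * ∑' x, ∑ a, ψ x * TL a x * curvAdj (curv TR) a x := by
  have hBψ : 0 ≤ Bψ := (abs_nonneg _).trans (hψ 0)
  set m : Form1 (d + 1) ℝ := fun b z => ψ z * TR b z with hm
  have hmB : ∀ b z, |m b z| ≤ Bψ * BR := by
    intro b z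
    rw [hm]; dsimp only
    rw [abs_mul]
    exact mul_le_mul (hψ z) (hTR b z) (abs_nonneg _) hBψ
  -- inner sum at fixed index-slot leg `(a, x)`: symmetric matrix entry, then split
  have hinner : ∀ a x, (∑' z, ∑ b, TR b z * ((1 / 2 : ℝ) * (ψ z - ψ x) * curvAdj (curv (delta1 b z)) a x)) =
      (1 / 2 : ℝ) * (∑ v ∈ cube (d + 1) 2, ∑ b, curvAdj (curv (delta1 a 0)) b v * m b (x + v)) -
        (1 / 2 : ℝ) * ψ x * curvAdj (curv TR) a x := by
    intro a x
    have hsplit : ∀ z, (∑ b, TR b z * ((1 / 2 : ℝ) * (ψ z - ψ x) * curvAdj (curv (delta1 b z)) a x)) =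
        (1 / 2 : ℝ) * (∑ b, m b z * curvAdj (curv (delta1 a x)) b z) - (1 / 2 : ℝ) * ψ x * (∑ b, TR b z * curvAdj (curv (delta1 a x)) b z) := by
      intro z
      rw [Finset.mul_sum, Finset.mul_sum, ← Finset.sum_sub_distrib]
      refine Finset.sum_congr rfl fun b _ => ?_
      rw [curvAdj_curv_delta1_symm a b x z, hm]
      ring
    have hs1 : Summable fun z => ∑ b, m b z * curvAdj (curv (delta1 a x)) b z :=
      ContactOneGaugeCellMaxwell.summable_mul_curvAdj_curv_delta1 m a x
    have hs2 : Summable fun z => ∑ b, TR b z * curvAdj (curv (delta1 a x)) b z :=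
      ContactOneGaugeCellMaxwell.summable_mul_curvAdj_curv_delta1 TR a x
    rw [tsum_congr hsplit, (hs1.mul_left _).tsum_sub (hs2.mul_left _), tsum_mul_left, tsum_mul_left,
      tsum_mul_curvAdj_curv_delta1_eq_window m a x, tsum_mul_curvAdj_curv_delta1 TR a x]
  have houter : ∀ x, (∑ a, TL a x * ∑' z, ∑ b, TR b z * ((1 / 2 : ℝ) * (ψ z - ψ x) * curvAdj (curv (delta1 b z)) a x)) =
      (1 / 2 : ℝ) * (∑ a, TL a x * (∑ v ∈ cube (d + 1) 2, ∑ b, curvAdj (curv (delta1 a 0)) b v * m b (x + v))) -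
        (1 / 2 : ℝ) * (∑ a, ψ x * TL a x * curvAdj (curv TR) a x) := by
    intro x
    rw [Finset.mul_sum, Finset.mul_sum, ← Finset.sum_sub_distrib]
    refine Finset.sum_congr rfl fun a _ => ?_
    rw [hinner a x]
    ring
  have hsA : Summable fun x => ∑ a, TL a x * (∑ v ∈ cube (d + 1) 2, ∑ b, curvAdj (curv (delta1 a 0)) b v * m b (x + v)) :=
    (summable_sum (s := cube (d + 1) 2) fun v (_ : v ∈ cube (d + 1) 2) => summable_mul_window hTL hmB v).congr
      fun x => (sum_mul_window_eq TL m x).symm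
  have hsB : Summable fun x => ∑ a, ψ x * TL a x * curvAdj (curv TR) a x := by
    refine summable_sum fun a _ => Summable.of_norm_bounded ((((hTL a).abs).mul_left Bψ).mul_right BM) (fun x => ?_)
    rw [Real.norm_eq_abs, abs_mul, abs_mul]
    have h1 := hψ x; have h3 := hMR a x
    have h0 : 0 ≤ |TL a x| := abs_nonneg _
    calc |ψ x| * |TL a x| * |curvAdj (curv TR) a x| ≤ Bψ * |TL a x| * BM := by gcongr
      _ = _ := by ring
  rw [tsum_congr houter, (hsA.mul_left _).tsum_sub (hsB.mul_left _), tsum_mul_left, tsum_mul_left,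
    tsum_mul_window_eq_tsum_mul_curvAdj_curv hTL hmB]

/-- [folklore] **THE INDEX-SLOT CELL BOUND** — same letters, SITE weights:
`|cell_idx| ≤ ½(d+1)·E_ψ·e^{κ₀}·(E_R·M_L + E_L·M_R)·L^{d+1}·Zl(κ₀/(4(d+1)))·e^{−(κ₀/12)(‖z_L−z₀‖∞ + ‖z_R−z₀‖∞)}`. -/
theorem abs_cellIdx_le {TL TR : Form1 (d + 1) ℝ} {L : ℕ} (hL : 1 ≤ L) {κ₀ : ℝ} (hκ : 0 < κ₀) {z₀ zL zR : Fin (d + 1) → ℤ}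
    {Eψ EL ER ML MR : ℝ} (hEψ : 0 ≤ Eψ) (hEL : 0 ≤ EL) (hER : 0 ≤ ER) (hML0 : 0 ≤ ML) (hMR0 : 0 ≤ MR)
    (hψ : ∀ x, |ψ x| ≤ Eψ * Real.exp (-(κ₀ * supNorm (quo L x - z₀))))
    (hTL : ∀ a x, |TL a x| ≤ EL * Real.exp (-(κ₀ * supNorm (quo L x - zL))))
    (hML : ∀ a x, |curvAdj (curv TL) a x| ≤ ML * Real.exp (-(κ₀ * supNorm (quo L x - zL))))
    (hTR : ∀ b z, |TR b z| ≤ ER * Real.exp (-(κ₀ * supNorm (quo L z - zR))))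
    (hMR : ∀ b z, |curvAdj (curv TR) b z| ≤ MR * Real.exp (-(κ₀ * supNorm (quo L z - zR)))) :
    |∑' x, ∑ a, TL a x * ∑' z, ∑ b, TR b z * ((1 / 2 : ℝ) * (ψ z - ψ x) * curvAdj (curv (delta1 b z)) a x)| ≤
      (1 / 2 : ℝ) * (((d : ℝ) + 1) * (Eψ * Real.exp κ₀) * (ER * ML + EL * MR)) *
        ((L : ℝ) ^ (d + 1) * Zl (d + 1) (κ₀ / (4 * ((d : ℝ) + 1))) * Real.exp (-(κ₀ / 12) * (supNorm (zL - z₀) + supNorm (zR - z₀)))) := by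
  have hId := cellIdx_eq (ψ := ψ) (TL := TL) (TR := TR) (fun a => summable_of_env hL hκ (hTL a)) (abs_le_of_env hκ.le hEψ hψ)
    (fun b z => abs_le_of_env hκ.le hER (hTR b) z) (fun a x => abs_le_of_env hκ.le hMR0 (hMR a) x)
  rw [hId]
  obtain ⟨_, hA⟩ := abs_tsum_weight_mul_mul_le (d := d) hL hκ (w := fun (_ : Fin (d + 1)) z => ψ z) (T := TR) (M := curvAdj (curv TL))
    (by positivity) hER hML0 (fun _ z => abs_site_weight_le (L := L) hκ.le hEψ hψ z) hTR hML
  obtain ⟨_, hB⟩ := abs_tsum_weight_mul_mul_le (d := d) hL hκ (w := fun (_ : Fin (d + 1)) x => ψ x) (T := TL) (M := curvAdj (curv TR))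
    (by positivity) hEL hMR0 (fun _ x => abs_site_weight_le (L := L) hκ.le hEψ hψ x) hTL hMR
  set BkR : ℝ := (L : ℝ) ^ (d + 1) * Zl (d + 1) (κ₀ / (4 * ((d : ℝ) + 1))) * Real.exp (-(κ₀ / 12) * (supNorm (zR - z₀) + supNorm (zL - z₀))) with hBkR
  set BkL : ℝ := (L : ℝ) ^ (d + 1) * Zl (d + 1) (κ₀ / (4 * ((d : ℝ) + 1))) * Real.exp (-(κ₀ / 12) * (supNorm (zL - z₀) + supNorm (zR - z₀))) with hBkL
  have hBk : BkR = BkL := by rw [hBkR, hBkL, add_comm (supNorm (zR - z₀))]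
  rw [hBk] at hA
  have htri := abs_sub (((1 / 2 : ℝ)) * ∑' z, ∑ b, ψ z * TR b z * curvAdj (curv TL) b z)
    ((1 / 2 : ℝ) * ∑' x, ∑ a, ψ x * TL a x * curvAdj (curv TR) a x)
  rw [abs_mul, abs_mul, abs_of_pos (by norm_num : (0 : ℝ) < 1 / 2)] at htri
  have hsum : (1 / 2 : ℝ) * (((d : ℝ) + 1) * (Eψ * Real.exp κ₀) * ER * ML * BkL) + (1 / 2 : ℝ) * (((d : ℝ) + 1) * (Eψ * Real.exp κ₀) * EL * MR * BkL) =
      (1 / 2 : ℝ) * (((d : ℝ) + 1) * (Eψ * Real.exp κ₀) * (ER * ML + EL * MR)) * BkL := by ring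
  rw [← hsum]
  linarith

end Cell

end

end Summit.QuantumFields.BalabanUV.Beta.GAN24.ContactOneGaugeCell
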